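import Mathlib
import HarnessLib

/-!
# Route `CoerciveSharpness`, crux `DimensionPinned` (item stmt-CriticalPhenomena-4662), line `Sketch`
# (idea `octave-telescoping-block-dock`): registered stub `stub_octaveTelescoping`

Pure real analysis ("octave telescoping", the `b_n`-trick read on block variances). A positive
sequence `v : ℕ → ℝ` whose consecutive ratios `λ_k := v (k+1) / v k` satisfy `λ_k ≥ m > 0` and the
power rate `|λ_{k+1} - λ_k| ≤ C (2^k)^{-θ}` (`θ > 0`) is two-sided geometric:
`A₁ Λ^k ≤ v k ≤ A₂ Λ^k` for all `k`, with `Λ = lim λ_k ≥ m` and `A₁ > 0`.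

Proof. Put `ρ := 2^{-θ} ∈ (0,1)`, so `(2^k)^{-θ} = ρ^k`, and `C' := max C 0`. Then
`dist (λ_k) (λ_{k+1}) ≤ C' ρ^k`, so `λ` is Cauchy (`cauchySeq_of_le_geometric`), converges to some
`Λ ≥ m` (`ge_of_tendsto'`), and `|λ_k - Λ| ≤ C' ρ^k / (1 - ρ)` (`dist_le_of_le_geometric_of_tendsto`).
Since `λ_k, Λ ≥ m > 0`, `|log λ_k - log Λ| ≤ |λ_k - Λ| / m` (`log x ≤ x - 1`). Telescoping
`log v K = log v 0 + Σ_{k<K} log λ_k` gives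
`|log v K - log v 0 - K log Λ| ≤ Σ_{k<K} C' ρ^k / (1-ρ) / m ≤ D := C' (1-ρ)⁻¹ / (1-ρ) / m`
(`geom_sum_Ico_le_of_lt_one`), and exponentiating, `v 0 e^{-D} Λ^K ≤ v K ≤ v 0 e^{D} Λ^K`.

Helper file (`--supports`); the composition lives in the lead's
`Theorems/CoerciveSharpnessDimensionPinned.lean`. No definition, no notation; `import Mathlib` only
(plus `HarnessLib`).
-/

noncomputable section

namespace Summit.CriticalPhenomena.Ising3DConformalLimit.Theorems.CoerciveSharpnessDimensionPinned

open Filter Topology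
open scoped BigOperators

-- adapted from `two_pow_rpow_neg` in Cruxes/DimensionPinned/CensusWeb.lean (crux workfile, not imported)
/-- `(2^i)^{-ω} = (2^{-ω})^i` for `i : ℕ`, `ω : ℝ` (natural power inside, real power outside, and
conversely). [folklore] -/
private theorem two_pow_rpow_neg (i : ℕ) (ω : ℝ) :
    ((2 : ℝ) ^ i) ^ (-ω) = ((2 : ℝ) ^ (-ω)) ^ i := by
  rw [← Real.rpow_natCast ((2 : ℝ) ^ (-ω)) i, ← Real.rpow_mul (by norm_num : (0 : ℝ) ≤ 2),
    mul_comm, Real.rpow_mul (by norm_num : (0 : ℝ) ≤ 2), Real.rpow_natCast]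

/-- For reals `a ≥ m > 0` and `b > 0`: `log b - log a ≤ |a - b| / m`, from
`log (b/a) ≤ b/a - 1 = (b - a)/a ≤ |a - b|/a ≤ |a - b|/m`. [folklore] -/
private theorem log_sub_log_le_abs_div {a b m : ℝ} (hm : 0 < m) (ha : m ≤ a) (hb : 0 < b) :
    Real.log b - Real.log a ≤ |a - b| / m := by
  have ha0 : 0 < a := hm.trans_le ha
  have h1 : Real.log (b / a) ≤ b / a - 1 := Real.log_le_sub_one_of_pos (div_pos hb ha0)
  rw [Real.log_div hb.ne' ha0.ne', div_sub_one ha0.ne'] at h1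
  have h2 : (b - a) / a ≤ |a - b| / m :=
    calc (b - a) / a ≤ |a - b| / a :=
          div_le_div_of_nonneg_right (by rw [abs_sub_comm]; exact le_abs_self _) ha0.le
      _ ≤ |a - b| / m := div_le_div_of_nonneg_left (abs_nonneg _) hm ha
  exact h1.trans h2

/-- For reals `a, b ≥ m > 0`: `|log a - log b| ≤ |a - b| / m` (the logarithm is `1/m`-Lipschitz on
`[m, ∞)`). [folklore] -/
private theorem abs_log_sub_log_le {a b m : ℝ} (hm : 0 < m) (ha : m ≤ a) (hb : m ≤ b) :
    |Real.log a - Real.log b| ≤ |a - b| / m := by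
  rw [abs_sub_le_iff]
  constructor
  · have h := log_sub_log_le_abs_div hm hb (hm.trans_le ha)
    rwa [abs_sub_comm] at h
  · exact log_sub_log_le_abs_div hm ha (hm.trans_le hb)

/-- **Registered stub `stub_octaveTelescoping` of line `Sketch`, proved** (octave telescoping, pure real
analysis). If `v : ℕ → ℝ` is positive, its consecutive ratios satisfy `v (k+1) / v k ≥ m > 0`, and
the ratios have the power rate `|v (k+2) / v (k+1) - v (k+1) / v k| ≤ C (2^k)^{-θ}` with `θ > 0`, then
there are `Λ ≥ m`, `A₁ > 0` and `A₂` with `A₁ Λ^k ≤ v k ≤ A₂ Λ^k` for every `k` (in fact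
`Λ = lim v (k+1) / v k`, `A₁ = v 0 · e^{-D}`, `A₂ = v 0 · e^{D}` with
`D = max C 0 · (1-ρ)⁻² / m`, `ρ = 2^{-θ}`): geometric Cauchy rate of the ratios, `log` is
`1/m`-Lipschitz on `[m, ∞)`, telescoping of `log v`, geometric series, exponentiation. [folklore] -/
theorem stub_octaveTelescoping :
    ∀ (v : ℕ → ℝ) (m θ C : ℝ), 0 < m → 0 < θ →
      (∀ k : ℕ, 0 < v k) → (∀ k : ℕ, m ≤ v (k + 1) / v k) →
      (∀ k : ℕ, |v (k + 2) / v (k + 1) - v (k + 1) / v k| ≤ C * ((2:ℝ) ^ k) ^ (-θ)) →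
      ∃ Λ A₁ A₂ : ℝ, m ≤ Λ ∧ 0 < A₁ ∧ ∀ k : ℕ, A₁ * Λ ^ k ≤ v k ∧ v k ≤ A₂ * Λ ^ k := by
  intro v m θ C hm hθ hv hratio hrate
  -- the geometric ratio `ρ = 2^{-θ} ∈ (0,1)` with `(2^k)^{-θ} = ρ^k`
  obtain ⟨ρ, hρ0, hρ1, hρk⟩ :
      ∃ ρ : ℝ, 0 < ρ ∧ ρ < 1 ∧ ∀ k : ℕ, ((2 : ℝ) ^ k) ^ (-θ) = ρ ^ k :=
    ⟨(2 : ℝ) ^ (-θ), Real.rpow_pos_of_pos two_pos _,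
      Real.rpow_lt_one_of_one_lt_of_neg one_lt_two (neg_neg_of_pos hθ),
      fun k => two_pow_rpow_neg k θ⟩
  have h1ρ : 0 < 1 - ρ := sub_pos.2 hρ1
  -- a nonnegative rate constant
  set C' : ℝ := max C 0 with hC'
  have hC'0 : 0 ≤ C' := le_max_right _ _
  -- the octave ratios `lam k = v (k+1) / v k ≥ m`
  obtain ⟨lam, hlam⟩ : ∃ lam : ℕ → ℝ, ∀ k : ℕ, lam k = v (k + 1) / v k := ⟨_, fun _ => rfl⟩
  have hlam_m : ∀ k : ℕ, m ≤ lam k := fun k => by rw [hlam]; exact hratio k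
  have hdist : ∀ k : ℕ, dist (lam k) (lam (k + 1)) ≤ C' * ρ ^ k := by
    intro k
    rw [Real.dist_eq, abs_sub_comm, hlam (k + 1), hlam k]
    calc |v (k + 1 + 1) / v (k + 1) - v (k + 1) / v k| ≤ C * ((2 : ℝ) ^ k) ^ (-θ) := hrate k
      _ = C * ρ ^ k := by rw [hρk]
      _ ≤ C' * ρ ^ k := mul_le_mul_of_nonneg_right (le_max_left _ _) (pow_nonneg hρ0.le k)
  -- geometric Cauchy: `lam k → Λ ≥ m` with `|lam k - Λ| ≤ C' ρ^k / (1 - ρ)`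
  obtain ⟨Λ, hΛ⟩ := cauchySeq_tendsto_of_complete (cauchySeq_of_le_geometric ρ C' hρ1 hdist)
  have hmΛ : m ≤ Λ := ge_of_tendsto' hΛ hlam_m
  have hΛ0 : 0 < Λ := hm.trans_le hmΛ
  have hdistΛ : ∀ k : ℕ, |lam k - Λ| ≤ C' * ρ ^ k / (1 - ρ) := fun k => by
    rw [← Real.dist_eq]
    exact dist_le_of_le_geometric_of_tendsto ρ C' hρ1 hdist hΛ k
  -- logs: `log` is `1/m`-Lipschitz on `[m, ∞)`
  have hlog : ∀ k : ℕ, |Real.log (lam k) - Real.log Λ| ≤ C' * ρ ^ k / (1 - ρ) / m := fun k =>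
    (abs_log_sub_log_le hm (hlam_m k) hmΛ).trans (div_le_div_of_nonneg_right (hdistΛ k) hm.le)
  -- telescoping of `log v`
  have htel : ∀ K : ℕ,
      Real.log (v K) = Real.log (v 0) + ∑ k ∈ Finset.range K, Real.log (lam k) := by
    intro K
    induction K with
    | zero => simp
    | succ K ih =>
      rw [Finset.sum_range_succ, ← add_assoc, ← ih, hlam K,
        Real.log_div (hv (K + 1)).ne' (hv K).ne']
      ring
  -- finite geometric sums
  have hgeom : ∀ K : ℕ, ∑ k ∈ Finset.range K, ρ ^ k ≤ (1 - ρ)⁻¹ := by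
    intro K
    have h := geom_sum_Ico_le_of_lt_one hρ0.le hρ1 (m := 0) (n := K)
    rwa [pow_zero, one_div, ← Finset.range_eq_Ico] at h
  -- the uniform deviation bound
  have hdev : ∀ K : ℕ,
      |Real.log (v K) - Real.log (v 0) - K * Real.log Λ| ≤ C' * (1 - ρ)⁻¹ / (1 - ρ) / m := by
    intro K
    have hsum : Real.log (v K) - Real.log (v 0) - K * Real.log Λ
        = ∑ k ∈ Finset.range K, (Real.log (lam k) - Real.log Λ) := by
      rw [Finset.sum_sub_distrib, Finset.sum_const, Finset.card_range, nsmul_eq_mul, htel K]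
      ring
    rw [hsum]
    calc |∑ k ∈ Finset.range K, (Real.log (lam k) - Real.log Λ)|
        ≤ ∑ k ∈ Finset.range K, |Real.log (lam k) - Real.log Λ| := Finset.abs_sum_le_sum_abs _ _
      _ ≤ ∑ k ∈ Finset.range K, C' * ρ ^ k / (1 - ρ) / m := Finset.sum_le_sum fun k _ => hlog k
      _ = C' * (∑ k ∈ Finset.range K, ρ ^ k) / (1 - ρ) / m := by
          rw [Finset.mul_sum, Finset.sum_div, Finset.sum_div]
      _ ≤ C' * (1 - ρ)⁻¹ / (1 - ρ) / m :=
          div_le_div_of_nonneg_right (div_le_div_of_nonneg_right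
            (mul_le_mul_of_nonneg_left (hgeom K) hC'0) h1ρ.le) hm.le
  -- exponentiate
  set D : ℝ := C' * (1 - ρ)⁻¹ / (1 - ρ) / m with hD
  refine ⟨Λ, v 0 * Real.exp (-D), v 0 * Real.exp D, hmΛ, mul_pos (hv 0) (Real.exp_pos _),
    fun K => ?_⟩
  have hK := abs_le.1 (hdev K)
  have hexpK : Real.exp (Real.log (v 0) + K * Real.log Λ) = v 0 * Λ ^ K := by
    rw [Real.exp_add, Real.exp_log (hv 0), ← Real.log_pow, Real.exp_log (pow_pos hΛ0 K)]
  constructor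
  · calc v 0 * Real.exp (-D) * Λ ^ K = Real.exp (Real.log (v 0) + K * Real.log Λ + -D) := by
          rw [Real.exp_add, hexpK]; ring
      _ ≤ Real.exp (Real.log (v K)) := Real.exp_le_exp.2 (by linarith [hK.1])
      _ = v K := Real.exp_log (hv K)
  · calc v K = Real.exp (Real.log (v K)) := (Real.exp_log (hv K)).symm
      _ ≤ Real.exp (Real.log (v 0) + K * Real.log Λ + D) := Real.exp_le_exp.2 (by linarith [hK.2])
      _ = v 0 * Real.exp D * Λ ^ K := by rw [Real.exp_add, hexpK]; ring

end Summit.CriticalPhenomena.Ising3DConformalLimit.Theorems.CoerciveSharpnessDimensionPinned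

end
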